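import Mathlib
import Summits.NavierStokesRegularity.NavierStokesRegularity.Theorems.EulerZoomLiouvillePowerGaugeEulerLiouvilleWeakLambIdentity
import HarnessLib

/-!
# Crux `EulerZoomLiouville.PowerGaugeEulerLiouville` (stmt-NavierStokesRegularity-19832), stub `stub_nonSelfSimilarRest`:
# WEAK BELTRAMI SLICES HAVE VANISHING VELOCITY-TESTED LAMB CURL

Helper file (theorems only; `--supports stmt-NavierStokesRegularity-19832`; def-free; pure analysis).  Hand leafhand-ns-eulerzoomliouville-10 g3; sequel of
`…WeakLambIdentity`.

* `LambIdentity.integral_inner_apply_test_eq` — `∫⟪V, G η⟫ = −½ ∫ (div η) |V|²` (chain rule `hasWeakFDerivOn_norm_sq` on a ball, summed over an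
  orthonormal frame);
* `LambIdentity.integral_inner_fderiv_apply_self_eq_zero_of_lambFree` — if `tr G = 0` a.e. (incompressibility), the Lamb vector vanishes a.e.
  (`⟪G V, w⟫ = ⟪G w, V⟫` for all `w`: WEAK BELTRAMI, `ω × V = 0`) and `div η = 0`, then `∫⟪V, Dη[V]⟫ = 0` — the velocity-tested weak Lamb curl of
  hand g1's convention vanishes.

WHAT THIS IS NOT: nothing about Euler or Navier–Stokes by itself. [folklore; Evans2010 §5.2.3; MajdaBertozziCUP2002 §2.4]
-/

noncomputable section

-- flat `Theorems/<Route><Decl>…` files of one crux share the namespace of the crux (tree convention)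
set_option linter.dupNamespace false

open MeasureTheory Set Filter Topology Metric Function TopologicalSpace
open scoped RealInnerProductSpace NNReal ENNReal ContDiff

namespace Summit.NavierStokesRegularity.NavierStokesRegularity.Theorems.PowerGaugeEulerLiouville

open Literature.Analysis Literature.Analysis.FunctionSpaces Literature.Analysis.FluidPDE

namespace LambIdentity

variable {V : EuclideanSpace ℝ (Fin 3) → EuclideanSpace ℝ (Fin 3)}
  {G : EuclideanSpace ℝ (Fin 3) → EuclideanSpace ℝ (Fin 3) →L[ℝ] EuclideanSpace ℝ (Fin 3)}

/-- **`∫⟪V, G η⟫ = −½ ∫ (div η) |V|²`** for `V` with whole-space weak gradient `G`, `V, G ∈ L²_loc`, and a vector test field `η` (the chain rule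
`D|V|² = 2⟪V, G·⟫` tested with the components of `η`). [folklore; Evans2010 §5.2.3 Thm. 1 (iv)] -/
theorem integral_inner_apply_test_eq (hG : HasWeakFDerivOn (⊤ : Opens (EuclideanSpace ℝ (Fin 3))) volume V G)
    (hV2 : LocallyIntegrable (fun x => ‖V x‖ ^ 2) volume)
    (hG2 : LocallyIntegrable (fun x => ‖G x‖ ^ 2) volume)
    {η : EuclideanSpace ℝ (Fin 3) → EuclideanSpace ℝ (Fin 3)} (hη : IsTestFunctionOn (⊤ : Opens (EuclideanSpace ℝ (Fin 3))) η) :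
    ∫ x, ⟪V x, G x (η x)⟫ = -(1 / 2) * ∫ x, VectorCalculus.divergence η x * ‖V x‖ ^ 2 := by
  set b : OrthonormalBasis (Fin 3) ℝ (EuclideanSpace ℝ (Fin 3)) := EuclideanSpace.basisFun (Fin 3) ℝ with hb
  have hηd : Differentiable ℝ η := hη.contDiff.differentiable (by simp)
  -- ball, test components, `L²` facts
  obtain ⟨R, hR⟩ := (hη.hasCompactSupport.isCompact).isBounded.subset_closedBall (0 : EuclideanSpace ℝ (Fin 3))
  set Ω : Opens (EuclideanSpace ℝ (Fin 3)) := ⟨ball 0 (R + 1), isOpen_ball⟩ with hΩ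
  have hηΩ : tsupport η ⊆ (Ω : Set (EuclideanSpace ℝ (Fin 3))) := hR.trans (closedBall_subset_ball (by linarith))
  have hφ : ∀ i, IsTestFunctionOn Ω (fun x => ⟪b i, η x⟫) := fun i =>
    ⟨contDiff_const.inner ℝ hη.contDiff, hη.hasCompactSupport.mono (fun x hx => by intro h0; exact hx (by simp [h0])),
      (closure_minimal (fun x hx => by
        by_contra h0
        exact hx (by simp [image_eq_zero_of_notMem_tsupport h0])) (isClosed_tsupport η)).trans hηΩ⟩
  have hφd : ∀ i x v, fderiv ℝ (fun x => ⟪b i, η x⟫) x v = ⟪b i, fderiv ℝ η x v⟫ := by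
    intro i x v
    have h := ((innerSL ℝ (b i)).hasFDerivAt.comp x (hηd x).hasFDerivAt).fderiv
    have e : (fun x => ⟪b i, η x⟫) = (innerSL ℝ (b i)) ∘ η := by funext x; simp
    rw [e, h]
    simp [innerSL_apply_apply]
  have hGΩ : HasWeakFDerivOn Ω volume V G := HasWeakFDerivOn.mono_set_holds hG le_top
  have hKc : IsCompact (closedBall (0 : EuclideanSpace ℝ (Fin 3)) (R + 1)) := isCompact_closedBall _ _
  have hsub : (Ω : Set (EuclideanSpace ℝ (Fin 3))) ⊆ closedBall 0 (R + 1) := ball_subset_closedBall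
  have hVm : AEStronglyMeasurable V (volume.restrict (Ω : Set (EuclideanSpace ℝ (Fin 3)))) := hGΩ.locallyIntegrableOn.aestronglyMeasurable
  have hGm : AEStronglyMeasurable G (volume.restrict (Ω : Set (EuclideanSpace ℝ (Fin 3)))) :=
    hGΩ.locallyIntegrableOn_deriv.aestronglyMeasurable
  have hV2Ω : IntegrableOn (fun x => ‖V x‖ ^ 2) (Ω : Set (EuclideanSpace ℝ (Fin 3))) volume :=
    (hV2.integrableOn_isCompact hKc).mono_set hsub
  have hVL2 : MemLp V 2 (volume.restrict (Ω : Set (EuclideanSpace ℝ (Fin 3)))) := (memLp_two_iff_integrable_sq_norm hVm).2 hV2Ω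
  have hGL2 : MemLp G 2 (volume.restrict (Ω : Set (EuclideanSpace ℝ (Fin 3)))) :=
    (memLp_two_iff_integrable_sq_norm hGm).2 ((hG2.integrableOn_isCompact hKc).mono_set hsub)
  have hGv2 : ∀ v : EuclideanSpace ℝ (Fin 3), MemLp (fun x => G x v) 2 (volume.restrict (Ω : Set (EuclideanSpace ℝ (Fin 3)))) := by
    intro v
    refine MemLp.of_le_mul hGL2 ((ContinuousLinearMap.apply ℝ (EuclideanSpace ℝ (Fin 3)) v).continuous.comp_aestronglyMeasurable hGm)
      (c := ‖v‖) (Eventually.of_forall fun x => ?_)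
    rw [mul_comm]; exact ContinuousLinearMap.le_opNorm _ _
  have hcomp : ∀ v : EuclideanSpace ℝ (Fin 3), MemLp (fun x => ⟪V x, v⟫) 2 (volume.restrict (Ω : Set (EuclideanSpace ℝ (Fin 3)))) := by
    intro v
    refine MemLp.of_le_mul hVL2 (hVm.inner aestronglyMeasurable_const) (c := ‖v‖) (Eventually.of_forall fun x => ?_)
    rw [mul_comm]; exact norm_inner_le_norm _ _
  have hGcomp : ∀ v w : EuclideanSpace ℝ (Fin 3), MemLp (fun x => ⟪v, G x w⟫) 2 (volume.restrict (Ω : Set (EuclideanSpace ℝ (Fin 3)))) := by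
    intro v w
    have h1 : AEStronglyMeasurable (fun x => G x w) (volume.restrict (Ω : Set (EuclideanSpace ℝ (Fin 3)))) :=
      (ContinuousLinearMap.apply ℝ (EuclideanSpace ℝ (Fin 3)) w).continuous.comp_aestronglyMeasurable hGm
    refine MemLp.of_le_mul hGL2 (aestronglyMeasurable_const.inner h1) (c := ‖v‖ * ‖w‖) (Eventually.of_forall fun x => ?_)
    calc ‖⟪v, G x w⟫‖ ≤ ‖v‖ * ‖G x w‖ := norm_inner_le_norm _ _
      _ ≤ ‖v‖ * (‖G x‖ * ‖w‖) := mul_le_mul_of_nonneg_left (ContinuousLinearMap.le_opNorm _ _) (norm_nonneg _)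
      _ = ‖v‖ * ‖w‖ * ‖G x‖ := by ring
  -- the chain rule for `|V|²`, tested with `⟪bᵢ, η⟫` in the direction `bᵢ`
  have hsq := hasWeakFDerivOn_norm_sq hVL2 hGΩ hGv2
  have hi : ∀ i, ∫ x, ⟪b i, fderiv ℝ η x (b i)⟫ * ‖V x‖ ^ 2 = -∫ x, ⟪b i, η x⟫ * (2 * ⟪V x, G x (b i)⟫) := by
    intro i
    have key := hsq.integral_fderiv_smul_eq _ (b i) (hφ i)
    have h1 : ∀ x, x ∉ (Ω : Set (EuclideanSpace ℝ (Fin 3))) → fderiv ℝ (fun x => ⟪b i, η x⟫) x (b i) • ‖V x‖ ^ 2 = 0 := fun x hx => by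
      simp [fderiv_of_notMem_tsupport (𝕜 := ℝ) (fun h => hx ((hφ i).tsupport_subset h))]
    have h2 : ∀ x, x ∉ (Ω : Set (EuclideanSpace ℝ (Fin 3))) →
        ⟪b i, η x⟫ • (((2 : ℝ) • (innerSL ℝ (V x)).comp (G x)) (b i)) = 0 := fun x hx => by
      simp [image_eq_zero_of_notMem_tsupport (fun h => hx ((hφ i).tsupport_subset h))]
    rw [setIntegral_eq_integral_of_forall_compl_eq_zero h1, setIntegral_eq_integral_of_forall_compl_eq_zero h2] at key
    simp_rw [hφd] at key
    have e2 : (fun x => ⟪b i, η x⟫ • (((2 : ℝ) • (innerSL ℝ (V x)).comp (G x)) (b i))) =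
        fun x => ⟪b i, η x⟫ * (2 * ⟪V x, G x (b i)⟫) := by
      funext x
      simp only [smul_eq_mul, smul_apply, ContinuousLinearMap.comp_apply, innerSL_apply_apply]
    rw [e2] at key
    simpa only [smul_eq_mul] using key
  -- integrability of the summands
  have hψ1 : ∀ i, Continuous (fun x => ⟪b i, fderiv ℝ η x (b i)⟫) := fun i =>
    continuous_const.inner ((hη.contDiff.continuous_fderiv (by simp)).clm_apply continuous_const)
  have hψ1c : ∀ i, HasCompactSupport (fun x => ⟪b i, fderiv ℝ η x (b i)⟫) := fun i =>
    (hη.hasCompactSupport.fderiv_apply (𝕜 := ℝ) (b i)).mono (fun x hx => by intro h0; exact hx (by simp [h0]))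
  have hψ1Ω : ∀ i, tsupport (fun x => ⟪b i, fderiv ℝ η x (b i)⟫) ⊆ (Ω : Set (EuclideanSpace ℝ (Fin 3))) := by
    intro i
    have hs : support (fun x => ⟪b i, fderiv ℝ η x (b i)⟫) ⊆ tsupport η := fun x hx => by
      by_contra h0
      exact hx (by simp [fderiv_of_notMem_tsupport (𝕜 := ℝ) h0])
    exact (closure_minimal hs (isClosed_tsupport η)).trans hηΩ
  have iL : ∀ i, Integrable (fun x => ⟪b i, fderiv ℝ η x (b i)⟫ * ‖V x‖ ^ 2) volume := by
    intro i
    obtain ⟨M, hM⟩ := (hψ1 i).bounded_above_of_compact_support (hψ1c i)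
    have h2 : Integrable (fun x => ⟪b i, fderiv ℝ η x (b i)⟫ * ‖V x‖ ^ 2) (volume.restrict (Ω : Set (EuclideanSpace ℝ (Fin 3)))) :=
      hV2Ω.bdd_mul (hψ1 i).aestronglyMeasurable (Eventually.of_forall hM)
    refine (integrableOn_iff_integrable_of_support_subset ?_).1 h2
    intro x hx
    by_contra hxΩ
    exact hx (by simp [image_eq_zero_of_notMem_tsupport (fun h => hxΩ (hψ1Ω i h))])
  have iR : ∀ i, Integrable (fun x => ⟪b i, η x⟫ * (2 * ⟪V x, G x (b i)⟫)) volume := by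
    intro i
    -- `⟪V, G bᵢ⟫ = Σₖ ⟪V,bₖ⟫⟪bₖ, G bᵢ⟫`, each product of two `L²(Ω)` functions
    have h1 : ∀ k, Integrable (fun x => ⟪b i, η x⟫ * (⟪V x, b k⟫ * ⟪b k, G x (b i)⟫)) volume := fun k =>
      integrable_mul_mul_of_memLp (hcomp (b k)) (hGcomp (b k) (b i)) ((hφ i).contDiff.continuous) (hφ i).hasCompactSupport
        (hφ i).tsupport_subset
    have h2 := (integrable_finsetSum (Finset.univ : Finset (Fin 3)) fun k _ => h1 k).const_mul 2
    refine h2.congr (Eventually.of_forall fun x => ?_)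
    show 2 * ∑ k, ⟪b i, η x⟫ * (⟪V x, b k⟫ * ⟪b k, G x (b i)⟫) = ⟪b i, η x⟫ * (2 * ⟪V x, G x (b i)⟫)
    rw [← Finset.mul_sum, b.sum_inner_mul_inner]
    ring
  -- sum over the frame
  have hdiv : ∀ x, VectorCalculus.divergence η x * ‖V x‖ ^ 2 = ∑ i, ⟪b i, fderiv ℝ η x (b i)⟫ * ‖V x‖ ^ 2 := fun x => by
    rw [divergence_eq_sum_inner_fderiv b, Finset.sum_mul]
  have hGη : ∀ x, ⟪V x, G x (η x)⟫ = ∑ i, ⟪b i, η x⟫ * ⟪V x, G x (b i)⟫ := fun x => by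
    conv_lhs => rw [← b.sum_repr' (η x)]
    rw [map_sum, inner_sum]
    exact Finset.sum_congr rfl fun i _ => by rw [map_smul, inner_smul_right]
  have e1 : ∫ x, VectorCalculus.divergence η x * ‖V x‖ ^ 2 = -(2 * ∫ x, ⟪V x, G x (η x)⟫) := by
    simp_rw [hdiv]
    rw [integral_finsetSum _ fun i _ => iL i]
    simp_rw [hi]
    rw [Finset.sum_neg_distrib, ← integral_finsetSum _ fun i _ => iR i]
    simp_rw [hGη]
    rw [← integral_const_mul]
    congr 1
    refine integral_congr_ae (Eventually.of_forall fun x => ?_)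
    simp only [Finset.mul_sum]
    exact Finset.sum_congr rfl fun i _ => by ring
  rw [e1]
  ring

/-- **WEAK BELTRAMI SLICES HAVE VANISHING VELOCITY-TESTED LAMB CURL.**  If `V` has a whole-space weak gradient `G` with `V, G ∈ L²_loc`, `tr G = 0`
a.e. (`div V = 0`), and the Lamb vector vanishes a.e. — `⟪G(x)V(x), w⟫ = ⟪G(x)w, V(x)⟫` for all `w` (`(G − Gᵀ)V = ω × V = 0`: Beltrami) — then
`∫⟪V, Dη[V]⟫ = 0` for every divergence-free vector test field `η` (in particular every curl pair): by the weak Lamb identity the integral is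
`−∫⟪η, G V⟫ = −∫⟪V, G η⟫ = ½∫ (div η)|V|² = 0`. [folklore; MajdaBertozziCUP2002 §2.4] -/
theorem integral_inner_fderiv_apply_self_eq_zero_of_lambFree (hG : HasWeakFDerivOn (⊤ : Opens (EuclideanSpace ℝ (Fin 3))) volume V G)
    (hV2 : LocallyIntegrable (fun x => ‖V x‖ ^ 2) volume)
    (hG2 : LocallyIntegrable (fun x => ‖G x‖ ^ 2) volume)
    (htr : ∀ᵐ x ∂(volume : Measure (EuclideanSpace ℝ (Fin 3))),
      ∑ j, ⟪(EuclideanSpace.basisFun (Fin 3) ℝ) j, G x ((EuclideanSpace.basisFun (Fin 3) ℝ) j)⟫ = 0)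
    (hLamb : ∀ᵐ x ∂(volume : Measure (EuclideanSpace ℝ (Fin 3))), ∀ w : EuclideanSpace ℝ (Fin 3), ⟪G x (V x), w⟫ = ⟪G x w, V x⟫)
    {η : EuclideanSpace ℝ (Fin 3) → EuclideanSpace ℝ (Fin 3)} (hη : IsTestFunctionOn (⊤ : Opens (EuclideanSpace ℝ (Fin 3))) η)
    (hdivη : ∀ x, VectorCalculus.divergence η x = 0) :
    ∫ x, ⟪V x, fderiv ℝ η x (V x)⟫ = 0 := by
  rw [integral_inner_fderiv_apply_self_eq hG hV2 hG2 hη]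
  have e1 : (fun x => ⟪η x, G x (V x)⟫ + ⟪V x, η x⟫ *
      ∑ j, ⟪(EuclideanSpace.basisFun (Fin 3) ℝ) j, G x ((EuclideanSpace.basisFun (Fin 3) ℝ) j)⟫) =ᵐ[volume]
      fun x => ⟪V x, G x (η x)⟫ := by
    filter_upwards [htr, hLamb] with x hx hL
    rw [hx, mul_zero, add_zero, real_inner_comm, hL (η x), real_inner_comm]
  rw [integral_congr_ae e1, integral_inner_apply_test_eq hG hV2 hG2 hη]
  simp [hdivη]

end LambIdentity

end Summit.NavierStokesRegularity.NavierStokesRegularity.Theorems.PowerGaugeEulerLiouville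

end
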